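import Literature.AnabelianGeometry.AbsoluteAnabelian.AbsTopIII.KummerPU
import Literature.AnabelianGeometry.AbsoluteAnabelian.AbsTopIII.CyclotomeH1Restriction
import Literature.AnabelianGeometry.AbsoluteAnabelian.AbsTopIII.KummerFaithfulPadicConsequences
import Literature.AnabelianGeometry.AbsoluteAnabelian.AbsTopIII.CurveModelSchemaWitnesses
import HarnessLib

/-!
# [AbsTopIII] Prop. 1.6 (iii) (kernel form) and Prop. 1.8 (ii) relative to a model:
# INSTANCE FORMS of `IntrinsicKummerModel.Prop_1_6_iii_ker` (FACT-LIST F-0378) and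
# `IntrinsicKummerModel.Prop_1_8_ii` (F-0380) at LABELLED TOY CARRIERS with every binder inhabited

S. Mochizuki, *Topics in Absolute Anabelian Geometry III: Global Reconstruction Algorithms*
[MochizukiAbsTopIII2015], §1 (manuscript pagination, lit key `paper:url-5493eb38cbb7`): Prop. 1.6 (iii)
p. 35 "Suppose that `U = X ∖ S`, where `S ⊆ X(k)` is a finite subset. Then restricting cohomology classes
of `Π_U` to the various `I_x` for `x ∈ S` yields a natural exact sequence
`1 → (k^×)^∧ → H¹(Π_U, M_X) → ⊕_{x ∈ S} Ẑ`"; Prop. 1.8 (ii) p. 36 "a class `η ∈ P_U ⋂ H¹(G_k, M_X)` is the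
Kummer class of an NF-constant `∈ k^×` if and only if there exist a nonconstant NF-rational function
`f ∈ Γ(U, 𝒪_U^×)` and an NF-point `x` [...] such that `κ_U(f)|_x = η|_{G_{k_x}}`" (printed proof p. 36
l. 42–50); the classical description `H¹ = ` continuous crossed homomorphisms modulo principal ones
[cite: SerreGaloisCohomology1997, I §2.3].

PROOF-ONLY companion (cell abc-iut, block F, seat abc-iut-f-072 gen 13, KEY row «INST59G2»; no `def`,
no `instance`, no notation, no new named fact) of abc-iut-L4-t1's `KummerPU.lean` (imported, never
edited).

CONTEXT.  Both rows are NAMED FACTS RELATIVE TO A MODEL `M : IntrinsicKummerModel` (the interface the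
étale `π₁` of hyperbolic curves with its geometric Kummer map WOULD provide; not constructed in the
tree).  Their universal closures over all interfaces are REFUTED in the tree (`not_forall_prop_1_6_iii_ker`,
abc-iut-f-085; `not_forall_prop_1_8_ii`, abc-iut-f-085 / abc-iut-w5-d101), and the only instance forms of
record were DEGENERATE in the curve binder (`prop_1_6_iii_ker_of_isEmpty_curve`,
`prop_1_8_ii_of_isEmpty_curve`: interfaces with NO curves, demoted by the F-lit census because the binder
type is empty).  This file supplies, for each row, `∃`-WITNESSES whose head conjunct IS the row's
declaration and whose remaining conjuncts DISPLAY that every hypothesis binder of the row fires at the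
witness (a curve `U`, `U ⊆ U` cofinite open, `U` proper and scheme-like of genus label `2`, base field
Kummer-faithful — `ℚ` by `isKummerFaithful_rat`, `ℚ_p` by `isKummerFaithful_padic` —, one RATIONAL cusp,
`U` an NF-curve, an NF-point, a NONCONSTANT NF-rational regular unit, a class in `P_U ⋂ H¹(G_k, M_X)`).

THE TOY CARRIERS (HONEST LABEL «INSTANCE at toy carrier», not models of any curve; the junk shape of
abc-iut-f-084's test model in `KummerIntrinsicSchemaNegative.lean` with the NF-constant flag switched on,
over an ARBITRARY extension).  Given a field `k` of characteristic zero, an extension `E = (Π ↠ G)` with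
`G ≅ G_k` and a section `s : G → Π`: ONE curve `U = X` with `Π_U := Π`, `res := 𝟙`; ONE cusp with
decomposition group `Π` (rational; inertia group `I = Π ⊓ Δ = Δ`); ONE closed point, `k`-rational with
section `s` and decomposition group `D_x = s(G)`, flagged NF; `K_U := k(X) = RatFunc k`, `ord ≡ 0` (every
unit regular), all NF-flags `True`; the TRIVIAL Kummer map `κ_U ≡ 0`.  Instantiated at `Π = G_k`
(identity augmentation, `Δ = 1`, `s = id`) and at abc-iut-f-076's `CurveModelSchemaWitness.toyExt k H`
(`Π = G_k × H ↠ G_k` for ANY profinite `H`, `Δ = {1} × H` NON-trivial, `s = inl`).  At these carriers: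

* Prop. 1.6 (iii) (kernel form, F-0378) holds at EVERY extension `E`: the single cusp has `I = Π ⊓ Δ`,
  so "`η|_{I_c} = 0` for every cusp `c`" and "`η ∈ Ker(res_Δ)`" are the same vanishing, transported
  along `Π ⊓ Δ = Δ` (`cyclotomeModH1Res_eq_zero_iff_of_eq`) — with `Δ = {1} × H ≅ H` non-trivial at
  `toyExt k H` (for `H = Ẑ` the cusp is even abc-iut-f-076's toy cyclotome presentation, `I ≅ Ẑ`);
* Prop. 1.8 (ii) (F-0380) holds with CONTENT on both sides when `s(G) = Π` (forcing `Δ = 1`): for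
  `η ∈ P_U ⋂ H¹(G_k, M_X)`, "`η = κ_U(c)` for an NF-constant `c`" reads `η = 0` (`κ_U ≡ 0`), and
  "`κ_U(f)|_x = η|_{D_x}` for the nonconstant NF-rational unit `f = X` and the NF-point `x`" reads
  `η|_{Π_U} = 0`, which is `η = 0` because restriction to the whole group is injective
  (`cyclotomeModH1Res_top_eq_zero_iff`, from the tree's crossed-homomorphism criterion).  For `Δ ≠ 1` the
  step "`η|_Δ = 0 ∧ η|_{s(G)} = 0 ⟹ η = 0`" needs the triviality of the inner action of `Δ` on
  `H²(Δ, Ẑ)` — not in the tree; so F-0380 is recorded at `Δ = 1` only.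

Also here: `cyclotomeModH1Res_eq_zero_of_eq_bot` (`H¹(1, V) = 0`: restriction to a trivial subgroup
vanishes).  WHAT THIS IS NOT: not the printed theorem (whose content — Kummer theory over Kummer-faithful
fields, the synchronizations `I_x ⥲ M_X`, the value-surjectivity `X_NF(k̄_NF) ↠ ℙ¹(k̄_NF)` — stays a named
input at the intended étale-`π₁` instance); the carriers have `κ_U ≡ 0` and no anabelian content.
Refereed pre-IUT material typed statements-first (D-0014); typed ≠ proved; an instance-form theorem about
OUR typed statement ≠ a theorem about [AbsTopIII] in print; nothing here bears on [IUTchIII] Cor. 3.12 or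
takes a side; axioms standard.
-/

noncomputable section

open CategoryTheory

universe u

namespace Literature.AnabelianGeometry.AbsoluteAnabelian.AbsTopIII

/-! ### Three restriction lemmas for `H¹(Π_U, M_X(Λ))` -/

section Res

variable {E' E : FundamentalExtension.{u}} (Λ : Type u) [AddCommGroup Λ] [TopologicalSpace Λ]
  [IsTopologicalAddGroup Λ] (r : E' ⟶ E)

/-- Transport of "`η|_D = 0`" along an equality of subgroups (the restriction targets depend on `D`).
[cite: SerreGaloisCohomology1997, I §2.3] -/
theorem cyclotomeModH1Res_eq_zero_iff_of_eq {D₁ D₂ : Subgroup E'.arith} (h : D₁ = D₂)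
    (η : cyclotomeModH1 r Λ) :
    (cyclotomeModH1Res r Λ D₁).hom η = 0 ↔ (cyclotomeModH1Res r Λ D₂).hom η = 0 := by
  subst h
  exact Iff.rfl

/-- **`H¹(1, V) = 0`**: the restriction of every class of `H¹(Π_U, M_X(Λ))` to a subgroup `D = 1`
vanishes (the zero vector is a principal vector on `D`, since crossed homomorphisms vanish at `1`).
[cite: SerreGaloisCohomology1997, I §2.3] -/
theorem cyclotomeModH1Res_eq_zero_of_eq_bot (D : Subgroup E'.arith) (hD : D = ⊥)
    (η : cyclotomeModH1 r Λ) : (cyclotomeModH1Res r Λ D).hom η = 0 := by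
  subst hD
  obtain ⟨f, hf, rfl⟩ := ContinuousCohomology.exists_crossedHomClass_eq _ η
  rw [res_crossedHomClass_eq_zero_iff]
  refine ⟨0, fun d => ?_⟩
  have hd : (d : E'.arith) = 1 := (Subgroup.mem_bot).1 d.2
  rw [hd, map_zero, sub_zero]
  exact crossedHom_one Λ r f hf

/-- **Restriction to the whole group is injective**: `η|_{Π} = 0 ↔ η = 0` in `H¹(Π_U, M_X(Λ))` (a
principal vector on `⊤` is a principal vector). [cite: SerreGaloisCohomology1997, I §2.3] -/
theorem cyclotomeModH1Res_top_eq_zero_iff (η : cyclotomeModH1 r Λ) :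
    (cyclotomeModH1Res r Λ ⊤).hom η = 0 ↔ η = 0 := by
  obtain ⟨f, hf, rfl⟩ := ContinuousCohomology.exists_crossedHomClass_eq _ η
  rw [res_crossedHomClass_eq_zero_iff, ContinuousCohomology.crossedHomClass_eq_zero_iff]
  constructor
  · rintro ⟨v, hv⟩
    have hv' : ∀ g : E'.arith, f g = cyclotomeModRep E Λ (r.arith g) v - v :=
      fun g => hv ⟨g, Subgroup.mem_top g⟩
    refine ⟨v, ?_, hv'⟩
    have h1 : (fun g : E'.arith => cyclotomeModRep E Λ (r.arith g) v) = fun g => f g + v := by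
      funext g
      rw [hv' g, sub_add_cancel]
    change Continuous fun g : E'.arith => cyclotomeModRep E Λ (r.arith g) v
    rw [h1]
    exact f.continuous.add continuous_const
  · rintro ⟨v, -, hv⟩
    exact ⟨v, fun d => hv d⟩

end Res

/-! ### The toy carrier over an arbitrary extension and the two instance forms -/

namespace IntrinsicKummerModel

/-- **MASTER WITNESS (toy carrier over a Kummer-faithful `k` and an ARBITRARY extension `E` with
`G ≅ G_k` and a section `s`; HONEST LABEL: toy carrier, not a model of any curve).**  ONE curve `U = X`
over `k` with `Π_U := Π_E`, `res := 𝟙`, one cusp with `D = Π` (so `I = Π ⊓ Δ`), one `k`-rational NF-point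
with section `s` and `D_x = s(G)`, `K_U := k(X)`, `ord ≡ 0`, NF-flags `True`, `κ_U ≡ 0` — at which
`Prop_1_6_iii_ker` (F-0378) HOLDS, `Prop_1_8_ii` (F-0380) HOLDS as soon as `s(G) = Π`, and every
hypothesis binder of both rows FIRES: displayed are the curve (whose extension IS `E`), the cofinite-open
and properness witnesses, the scheme flag, the genus bound, Kummer-faithfulness of the base, an inhabited
type of cusps all rational, the NF-curve flag, an inhabited type of points all NF, a NONCONSTANT
NF-rational regular unit (the indeterminate `X`), and a class of `P_U ⋂ H¹(G_k, M_X)`.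
[cite: MochizukiAbsTopIII2015, Prop 1.8 (ii) p.36] -/
theorem exists_toyCarrier_prop_1_6_iii_ker_and_prop_1_8_ii (k : Type u) [Field k] [CharZero k]
    (hk : IsKummerFaithful k) (E : FundamentalExtension.{u}) (eG : E.gal ≅ absoluteGaloisGrp k)
    (s : E.Section) :
    ∃ M : IntrinsicKummerModel.{u},
      M.Prop_1_6_iii_ker ∧ (s.decompositionGroup = ⊤ → M.Prop_1_8_ii) ∧
        ∃ (U : M.Curve) (h : M.IsCofiniteOpen U U) (hX : M.IsProper U),
          M.ext U = E ∧ M.IsScheme U ∧ 2 ≤ M.genus U ∧ IsKummerFaithful (M.base U) ∧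
            Nonempty (M.cusps U).Cusp ∧ (∀ c : (M.cusps U).Cusp, (M.cusps U).IsRational c) ∧
            M.IsNFCurve U ∧ Nonempty (M.Point U) ∧ (∀ y : M.Point U, M.IsNFPoint U y) ∧
            (∃ g : M.regularUnits U,
              M.IsNFRational U ((g : (M.FunctionField U)ˣ) : M.FunctionField U) ∧
                ((g : (M.FunctionField U)ˣ) : M.FunctionField U) ∉
                  Set.range (algebraMap (M.base U) (M.FunctionField U))) ∧
            ∃ η : cyclotomeModH1 (M.res h) ZHatCoeff.{u}, η ∈ M.PU h hX ∧ η ∈ M.galoisClasses h := by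
  -- one cusp with decomposition group `Π`
  let C : E.CuspidalData :=
    { Cusp := PUnit.{u + 1}, Dcusp := fun _ => ⊤, Icusp := fun _ => ⊤ ⊓ E.geom
      Icusp_eq := fun _ => rfl
      isClosed_Dcusp := fun _ => by
        rw [Subgroup.coe_top]
        exact isClosed_univ
      eq_of_conj := fun _ _ _ _ => rfl }
  let M : IntrinsicKummerModel.{u} :=
    { Curve := PUnit.{u + 2}
      base := fun _ => k
      instField := fun _ => inferInstanceAs (Field k)
      instCharZero := fun _ => inferInstanceAs (CharZero k)
      ext := fun _ => E
      galIso := fun _ => eG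
      cusps := fun _ => C
      IsProper := fun _ => True
      IsScheme := fun _ => True
      genus := fun _ => 2
      FunctionField := fun _ => RatFunc k
      instFunctionField := fun _ => inferInstanceAs (Field (RatFunc k))
      instAlgebra := fun _ => inferInstanceAs (Algebra k (RatFunc k))
      Point := fun _ => PUnit.{u + 1}
      decomp := fun _ _ => s.decompositionGroup
      IsNFCurve := fun _ => True
      IsNFPoint := fun _ _ => True
      IsNFRational := fun _ _ => True
      IsNFConstant := fun _ _ => True
      NFFunctionField := fun _ => RatFunc k
      instNFFunctionField := fun _ => inferInstanceAs (Field (RatFunc k))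
      IsStrictlyBelyiType := fun _ => True
      IsCofiniteOpen := fun _ _ => True
      res := fun _ => 𝟙 E
      IsRationalPt := fun _ _ => True
      ptSection := fun _ _ => s
      ptSection_range := fun _ _ => rfl
      ord := fun _ => 1
      kummerMap := fun _ _ => 1 }
  -- the nonconstant regular unit `X ∈ Γ(U, 𝒪_U^×) = k(X)^×`
  let Xu : M.regularUnits PUnit.unit :=
    ⟨Units.mk0 RatFunc.X RatFunc.X_ne_zero, (M.mem_regularUnits _).2 fun _ => rfl⟩
  have hXnc : ((Xu : (M.FunctionField PUnit.unit)ˣ) : M.FunctionField PUnit.unit) ∉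
      Set.range (algebraMap (M.base PUnit.unit) (M.FunctionField PUnit.unit)) :=
    ratFuncX_not_mem_range_algebraMap k
  have hcusp : ∀ c : (M.cusps PUnit.unit).Cusp, (M.cusps PUnit.unit).IsRational c := by
    intro c g _
    obtain ⟨y, hy⟩ := E.aug_surjective g
    exact ⟨y, Subgroup.mem_top y, hy⟩
  -- `κ_U ≡ 0`: every Kummer class is `0`
  have hκ : ∀ (h : M.IsCofiniteOpen PUnit.unit PUnit.unit) (hX : M.IsProper PUnit.unit)
      (f : M.regularUnits PUnit.unit), Multiplicative.toAdd (M.kummerMap h hX f) = 0 :=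
    fun _ _ _ => rfl
  refine ⟨M, ?_, ?_, PUnit.unit, trivial, trivial, rfl, trivial, le_rfl, hk, ⟨PUnit.unit⟩, hcusp,
    trivial, ⟨PUnit.unit⟩, fun _ => trivial, ⟨Xu, trivial, hXnc⟩, 0, zero_mem _, zero_mem _⟩
  · -- Prop. 1.6 (iii), kernel form: `I_c = Π ⊓ Δ = Δ` for the single cusp
    rintro ⟨⟩ ⟨⟩ h hX - - - - - η
    have hI := cyclotomeModH1Res_eq_zero_iff_of_eq ZHatCoeff.{u} (M.res h) (top_inf_eq E.geom) η
    constructor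
    · intro hc
      rw [M.mem_galoisClasses_iff h η]
      exact hI.1 (hc PUnit.unit)
    · intro hg c
      rw [M.mem_galoisClasses_iff h η] at hg
      exact hI.2 hg
  · -- Prop. 1.8 (ii), when `D_x = s(G) = Π`: `η = κ_U(c) = 0` iff `η|_{D_x} = η|_{Π} = 0`
    rintro hs ⟨⟩ ⟨⟩ h hX - - - - - - - η - -
    have htop : M.classRes h (M.decomp PUnit.unit PUnit.unit) η = 0 ↔ η = 0 :=
      (cyclotomeModH1Res_eq_zero_iff_of_eq ZHatCoeff.{u} (M.res h) hs η).trans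
        (cyclotomeModH1Res_top_eq_zero_iff ZHatCoeff.{u} (M.res h) η)
    constructor
    · rintro ⟨c, hc, -, hcη⟩
      rw [hκ] at hcη
      refine ⟨Xu, PUnit.unit, trivial, hXnc, trivial, ?_⟩
      rw [hκ, ← hcη]
    · rintro ⟨f, y, -, -, -, hfy⟩
      obtain ⟨⟩ := y
      rw [hκ] at hfy
      have h0 : M.classRes h (M.decomp PUnit.unit PUnit.unit) η = 0 := by
        rw [← hfy]
        exact map_zero _
      have hη : η = 0 := htop.1 h0
      refine ⟨1, (M.mem_regularUnits _).2 fun _ => rfl, trivial, ?_⟩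
      rw [hκ, hη]

/-! ### F-0378 `Prop_1_6_iii_ker` -/

/-- **F-0378 `IntrinsicKummerModel.Prop_1_6_iii_ker` — INSTANCE FORM at the toy carrier over `ℚ` with
`Π_U = G_ℚ`** (`Δ = 1`; `ℚ` Kummer-faithful: `isKummerFaithful_rat`), the row's hypothesis telescope
displayed INHABITED (curve, cofinite open, proper, scheme-like, genus `≥ 2`, Kummer-faithful base, an
inhabited type of cusps all rational, an inhabited `H¹(Π_U, M_X(Ẑ))`) and the degeneracy `Δ = 1` displayed
as bijectivity of the augmentation.  HONEST LABEL: toy carrier (`I_c = Δ`, `κ_U ≡ 0`).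
[cite: MochizukiAbsTopIII2015, Prop 1.6 (iii) p.35] -/
theorem prop_1_6_iii_ker_toyCarrier_rat :
    ∃ M : IntrinsicKummerModel.{0},
      M.Prop_1_6_iii_ker ∧
        ∃ (U : M.Curve) (h : M.IsCofiniteOpen U U),
          M.IsProper U ∧ M.IsScheme U ∧ 2 ≤ M.genus U ∧ IsKummerFaithful (M.base U) ∧
            Nonempty (M.cusps U).Cusp ∧ (∀ c : (M.cusps U).Cusp, (M.cusps U).IsRational c) ∧
            Nonempty (cyclotomeModH1 (M.res h) ZHatCoeff.{0}) ∧ Function.Bijective (M.ext U).aug := by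
  let E : FundamentalExtension.{0} :=
    { arith := absoluteGaloisGrp ℚ, gal := absoluteGaloisGrp ℚ
      aug := ContinuousMonoidHom.id _, aug_surjective := Function.surjective_id }
  obtain ⟨M, h16, -, U, h, hX, hE, hs, hg, hk, hc, hrat, -, -, -, -, η, -, -⟩ :=
    exists_toyCarrier_prop_1_6_iii_ker_and_prop_1_8_ii ℚ isKummerFaithful_rat E (Iso.refl _)
      ⟨ContinuousMonoidHom.id _, fun _ => rfl⟩
  exact ⟨M, h16, U, h, hX, hs, hg, hk, hc, hrat, ⟨η⟩, by rw [hE]; exact Function.bijective_id⟩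

/-- **F-0378 — INSTANCE FORM at the toy carrier over `ℚ_p` with `Π_U = G_{ℚ_p}`** (`Δ = 1`;
`isKummerFaithful_padic`), same display.  HONEST LABEL: toy carrier.
[cite: MochizukiAbsTopIII2015, Prop 1.6 (iii) p.35] -/
theorem prop_1_6_iii_ker_toyCarrier_padic (p : ℕ) [Fact p.Prime] :
    ∃ M : IntrinsicKummerModel.{0},
      M.Prop_1_6_iii_ker ∧
        ∃ (U : M.Curve) (h : M.IsCofiniteOpen U U),
          M.IsProper U ∧ M.IsScheme U ∧ 2 ≤ M.genus U ∧ IsKummerFaithful (M.base U) ∧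
            Nonempty (M.cusps U).Cusp ∧ (∀ c : (M.cusps U).Cusp, (M.cusps U).IsRational c) ∧
            Nonempty (cyclotomeModH1 (M.res h) ZHatCoeff.{0}) ∧ Function.Bijective (M.ext U).aug := by
  let E : FundamentalExtension.{0} :=
    { arith := absoluteGaloisGrp ℚ_[p], gal := absoluteGaloisGrp ℚ_[p]
      aug := ContinuousMonoidHom.id _, aug_surjective := Function.surjective_id }
  obtain ⟨M, h16, -, U, h, hX, hE, hs, hg, hk, hc, hrat, -, -, -, -, η, -, -⟩ :=
    exists_toyCarrier_prop_1_6_iii_ker_and_prop_1_8_ii ℚ_[p] (isKummerFaithful_padic p) E (Iso.refl _)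
      ⟨ContinuousMonoidHom.id _, fun _ => rfl⟩
  exact ⟨M, h16, U, h, hX, hs, hg, hk, hc, hrat, ⟨η⟩, by rw [hE]; exact Function.bijective_id⟩

/-- **F-0378 — INSTANCE FORM at the toy carrier over `ℚ_p` with `Π_U = G_{ℚ_p} × H ↠ G_{ℚ_p}` for ANY
profinite group `H`** (abc-iut-f-076's `CurveModelSchemaWitness.toyExt ℚ_p H`: `Δ_U = {1} × H` is
NON-TRIVIAL for `H ≠ 1`; the single cusp has `I = Δ ≅ H` — for `H = Ẑ` it is f-076's toy cyclotome
presentation; the NF-point is rational with section `inl` and `D_x = G_{ℚ_p} × {1}`), same display plus the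
identification of the curve's extension with `toyExt ℚ_p H`.  HONEST LABEL: toy carrier (`κ_U ≡ 0`; the
row holds because `I_c = Π ⊓ Δ = Δ`). [cite: MochizukiAbsTopIII2015, Prop 1.6 (iii) p.35] -/
theorem prop_1_6_iii_ker_toyCarrier_prod (p : ℕ) [Fact p.Prime] (H : ProfiniteGrp.{0}) :
    ∃ M : IntrinsicKummerModel.{0},
      M.Prop_1_6_iii_ker ∧
        ∃ (U : M.Curve) (h : M.IsCofiniteOpen U U),
          M.IsProper U ∧ M.ext U = CurveModelSchemaWitness.toyExt ℚ_[p] H ∧ M.IsScheme U ∧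
            2 ≤ M.genus U ∧ IsKummerFaithful (M.base U) ∧
            Nonempty (M.cusps U).Cusp ∧ (∀ c : (M.cusps U).Cusp, (M.cusps U).IsRational c) ∧
            Nonempty (cyclotomeModH1 (M.res h) ZHatCoeff.{0}) := by
  obtain ⟨M, h16, -, U, h, hX, hE, hs, hg, hk, hc, hrat, -, -, -, -, η, -, -⟩ :=
    exists_toyCarrier_prop_1_6_iii_ker_and_prop_1_8_ii ℚ_[p] (isKummerFaithful_padic p)
      (CurveModelSchemaWitness.toyExt ℚ_[p] H) (Iso.refl _)
      ⟨ContinuousMonoidHom.inl _ _, fun _ => rfl⟩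
  exact ⟨M, h16, U, h, hX, hE, hs, hg, hk, hc, hrat, ⟨η⟩⟩

/-! ### F-0380 `Prop_1_8_ii` -/

/-- **F-0380 `IntrinsicKummerModel.Prop_1_8_ii` — INSTANCE FORM at the toy carrier over `ℚ` with
`Π_U = G_ℚ`** (`Δ = 1`, `D_x = s(G_ℚ) = Π_U`), the row's hypothesis telescope displayed INHABITED: curve,
cofinite open, proper, scheme-like, genus `≥ 2`, Kummer-faithful base (`isKummerFaithful_rat`), cusps all
rational, NF-curve, a NONCONSTANT NF-rational regular unit, an NF-point, and a class
`η ∈ P_U ⋂ H¹(G_k, M_X)`.  HONEST LABEL: toy carrier (`κ_U ≡ 0`): the row's `↔` reads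
"`η = 0 ↔ η|_{Π_U} = 0`", true by injectivity of restriction to the whole group.
[cite: MochizukiAbsTopIII2015, Prop 1.8 (ii) p.36] -/
theorem prop_1_8_ii_toyCarrier_rat :
    ∃ M : IntrinsicKummerModel.{0},
      M.Prop_1_8_ii ∧
        ∃ (U : M.Curve) (h : M.IsCofiniteOpen U U) (hX : M.IsProper U),
          M.IsScheme U ∧ 2 ≤ M.genus U ∧ IsKummerFaithful (M.base U) ∧
            (∀ c : (M.cusps U).Cusp, (M.cusps U).IsRational c) ∧ M.IsNFCurve U ∧
            (∃ g : M.regularUnits U,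
              M.IsNFRational U ((g : (M.FunctionField U)ˣ) : M.FunctionField U) ∧
                ((g : (M.FunctionField U)ˣ) : M.FunctionField U) ∉
                  Set.range (algebraMap (M.base U) (M.FunctionField U))) ∧
            (∃ y : M.Point U, M.IsNFPoint U y) ∧
            (∃ η : cyclotomeModH1 (M.res h) ZHatCoeff.{0}, η ∈ M.PU h hX ∧ η ∈ M.galoisClasses h) ∧
            Function.Bijective (M.ext U).aug := by
  let E : FundamentalExtension.{0} :=
    { arith := absoluteGaloisGrp ℚ, gal := absoluteGaloisGrp ℚ
      aug := ContinuousMonoidHom.id _, aug_surjective := Function.surjective_id }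
  let s : E.Section := ⟨ContinuousMonoidHom.id _, fun _ => rfl⟩
  have hsec : s.decompositionGroup = ⊤ :=
    MonoidHom.range_eq_top_of_surjective _ Function.surjective_id
  obtain ⟨M, -, h18, U, h, hX, hE, hs, hg, hk, -, hrat, hnf, ⟨y⟩, hy, hunit, η, hP, hG⟩ :=
    exists_toyCarrier_prop_1_6_iii_ker_and_prop_1_8_ii ℚ isKummerFaithful_rat E (Iso.refl _) s
  exact ⟨M, h18 hsec, U, h, hX, hs, hg, hk, hrat, hnf, hunit, ⟨y, hy y⟩, ⟨η, hP, hG⟩,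
    by rw [hE]; exact Function.bijective_id⟩

/-- **F-0380 — INSTANCE FORM at the toy carrier over `ℚ_p` with `Π_U = G_{ℚ_p}`** (`Δ = 1`;
`isKummerFaithful_padic`), same display.  HONEST LABEL: toy carrier.
[cite: MochizukiAbsTopIII2015, Prop 1.8 (ii) p.36] -/
theorem prop_1_8_ii_toyCarrier_padic (p : ℕ) [Fact p.Prime] :
    ∃ M : IntrinsicKummerModel.{0},
      M.Prop_1_8_ii ∧
        ∃ (U : M.Curve) (h : M.IsCofiniteOpen U U) (hX : M.IsProper U),
          M.IsScheme U ∧ 2 ≤ M.genus U ∧ IsKummerFaithful (M.base U) ∧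
            (∀ c : (M.cusps U).Cusp, (M.cusps U).IsRational c) ∧ M.IsNFCurve U ∧
            (∃ g : M.regularUnits U,
              M.IsNFRational U ((g : (M.FunctionField U)ˣ) : M.FunctionField U) ∧
                ((g : (M.FunctionField U)ˣ) : M.FunctionField U) ∉
                  Set.range (algebraMap (M.base U) (M.FunctionField U))) ∧
            (∃ y : M.Point U, M.IsNFPoint U y) ∧
            (∃ η : cyclotomeModH1 (M.res h) ZHatCoeff.{0}, η ∈ M.PU h hX ∧ η ∈ M.galoisClasses h) ∧
            Function.Bijective (M.ext U).aug := by
  let E : FundamentalExtension.{0} :=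
    { arith := absoluteGaloisGrp ℚ_[p], gal := absoluteGaloisGrp ℚ_[p]
      aug := ContinuousMonoidHom.id _, aug_surjective := Function.surjective_id }
  let s : E.Section := ⟨ContinuousMonoidHom.id _, fun _ => rfl⟩
  have hsec : s.decompositionGroup = ⊤ :=
    MonoidHom.range_eq_top_of_surjective _ Function.surjective_id
  obtain ⟨M, -, h18, U, h, hX, hE, hs, hg, hk, -, hrat, hnf, ⟨y⟩, hy, hunit, η, hP, hG⟩ :=
    exists_toyCarrier_prop_1_6_iii_ker_and_prop_1_8_ii ℚ_[p] (isKummerFaithful_padic p) E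
      (Iso.refl _) s
  exact ⟨M, h18 hsec, U, h, hX, hs, hg, hk, hrat, hnf, hunit, ⟨y, hy y⟩, ⟨η, hP, hG⟩,
    by rw [hE]; exact Function.bijective_id⟩

/-- **Joint form**: ONE toy carrier (over `ℚ`, `Π_U = G_ℚ`) at which F-0378 and F-0380 hold together —
the consumer-shaped record for the Thm. 1.9 (d)/(e) law binders `h16k h18ii`, with an inhabited curve
type. HONEST LABEL: toy carrier. [cite: MochizukiAbsTopIII2015, Thm 1.9 (d) p.37] -/
theorem exists_toyCarrier_prop_1_6_iii_ker_and_prop_1_8_ii_rat :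
    ∃ M : IntrinsicKummerModel.{0}, M.Prop_1_6_iii_ker ∧ M.Prop_1_8_ii ∧ Nonempty M.Curve := by
  let E : FundamentalExtension.{0} :=
    { arith := absoluteGaloisGrp ℚ, gal := absoluteGaloisGrp ℚ
      aug := ContinuousMonoidHom.id _, aug_surjective := Function.surjective_id }
  let s : E.Section := ⟨ContinuousMonoidHom.id _, fun _ => rfl⟩
  have hsec : s.decompositionGroup = ⊤ :=
    MonoidHom.range_eq_top_of_surjective _ Function.surjective_id
  obtain ⟨M, h16, h18, U, -⟩ :=
    exists_toyCarrier_prop_1_6_iii_ker_and_prop_1_8_ii ℚ isKummerFaithful_rat E (Iso.refl _) s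
  exact ⟨M, h16, h18 hsec, ⟨U⟩⟩

end IntrinsicKummerModel

end Literature.AnabelianGeometry.AbsoluteAnabelian.AbsTopIII
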